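import Summits.BirchSwinnertonDyer.BirchSwinnertonDyer.Theorems.ClassRecordThreeCornerTwinHalves
import Summits.BirchSwinnertonDyer.BirchSwinnertonDyer.Theorems.ClassRecordThreeCornerAtThreeBranchesDefs
import Summits.BirchSwinnertonDyer.Rank1Residual.X1.RankZeroPartner
import Literature.NumberTheory.GaloisCohomology.PoitouTateNumberField
import Summits.BirchSwinnertonDyer.Rank1Residual.GaloisImage.PropagatedConditionCardEP
import Summits.BirchSwinnertonDyer.BirchSwinnertonDyer.Theses.ClassRecordThree
import Summits.BirchSwinnertonDyer.BirchSwinnertonDyer.Theorems.ClassRecordThreeCornerAtThreeTwistWitnessOfTwinLowerModEight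
import Summits.BirchSwinnertonDyer.BirchSwinnertonDyer.Theorems.ClassRecordThreeCornerAtThreeUpperShimuraDefs
import HarnessLib

/-!
# Crux `CornerAtThreeW` (item stmt-BirchSwinnertonDyer-21420) — a STRENGTH CERTIFICATE: modulo named print, the twist-witness crux
# `CornerAtThreeW` ((L) ∧ (W) ∧ (U)) IMPLIES the ∀-(Tw) crux `CornerAtThree` (item 19111, aside) — i.e. `BSD(E^{(d_K)},3)` at EVERY odd Heegner
# twin of every corner curve (cell `bsd-stepL`, seat `bsd-stepL-corner3-p2` g16 = WIDTH-LEVER lane B; `--supports stmt-BirchSwinnertonDyer-21420 --as helper`)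

HONEST FRAMING: THEOREMS ONLY (no definition, no named fact, no `sorry`); every theorem is CONDITIONAL on its displayed binders; nothing here
is a BSD class theorem; no census label moves (T7); items 21420 ∕ 19111 are NOT closed and no registered stub is proved. BSD is proved for no curve.
This is EVIDENCE about the STRENGTH of the crux statement (planner ∕ director material for plan g37 RULING 33 and the director-gated RULING 40 (α)),
not progress on it.

THE FINDING. Plan g37 RULING 33 re-cut conjunct (Tw) of 19111 (`∀` odd Heegner twins: `BSDp Wd 3`) into the ONE-twin witness (W)
`CornerTwistWitness.CornerTwistWitnessAt W` and made `CornerAtThreeW := ∀ W, CornerStepLAt W ∧ CornerTwistWitnessAt W ∧ CornerUpperAt W` the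
load-bearing crux, «strictly weaker than (Tw) by `cornerTwistWitnessAt_of_cornerTwistAt` + Hoffstein–Luo». It is weaker AS A CONJUNCT; but the CRUX is
NOT weaker: because (L) `Three.CornerStepLAt W` and (U) `Three.CornerUpperAt W` are typed at EVERY odd-`d_K` Manin-good Heegner datum, their conjunction
pins `2·ord₃ [E(K):ℤP] = ord₃ #Ш(E/K) + 2·ord₃ ∏c` at every such datum (on `3 ∣ ∏c`; on `3 ∤ ∏c` Matar–Nekovář's printed bound replaces (U)), and with
multr1-p2's EXACT Gross–Zagier identity `v(q) + v(q_d) + v(∏c) + 2v(t_d) = 2v(I)`, `v(Ш_K) = v(Ш_W) + v(Ш_d)` and `BSD(E,3)` (which (L) ∧ (W) ∧ (U) give at the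
witness frame — the route's own squeeze `CornerTwinHalves.missingPPartAt_of_corner_of_twoTwins`) one gets the twin's EXACT `3`-part
`v(q_d) = v(Ш_d) + v(∏c_d) − 2v(t_d)` at EVERY frame, i.e. `BSDp Wd 3` for every odd Heegner twin. Hence, modulo print:

  `CornerAtThreeW (21420) ⟹ CornerAtThree (19111)`, and trivially conversely (p556532) — the two cruxes are EQUIVALENT.

CONSEQUENCES (for the planner; nothing applied here): (i) any line closing 21420 proves `BSD₃` of EVERY odd Heegner twist of every corner curve — in
particular the rank-`0` main-conjecture lower bound (`CornerAtThreeTwistLower`) and the twin's Kato half at every twin are OUTPUTS of the crux, whatever the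
line's inputs (lane B g16's r22 trades the former for (L) ∀ + the Kato half ∀ + one mod-8 witness — consistent with this); (ii) what the route CONSUMES of the
corner (`Theorems.multiplicativeRankOneAtThree_of_classRecord_upperB_of_twistWitness`: `BSD₃(E)` for corner `E`) needs (L) at ONE frame, (W) at that frame and
the consumer shape (U′) — so BOTH (L) and (U) as typed are over-strong by a ∀-over-frames, not only (U) (RULING 40 (α) addresses (U) alone).

* §1 `pPartRankZero_twist_of_indexBounds_of_missingPPartAt` — datum level: the twin's print shape `PPartRankZero Wd 3` from the two index inequalities at
  the datum, `BSD(E,3)` in Miller's currency (`Typed.MissingPPartAt W 3`) and print (Gross–Zagier, Kolyvagin, GZK, modularity, parametrisation supply for the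
  rationality of `L(Wd,1)/Ω(Wd)` — `X1.RankZeroPartner.exists_rat_entireLFunction_one_div_realPeriodRat`).
* §2 `cornerTwistAt_of_stepL_of_twistWitness_of_upper` — curve level: (L) ∧ (W) ∧ (U) ⟹ `Three.CornerTwistAt W`, modulo print {GZ, Ko, GZK, mod, nf, Maz,
  par, Matar–Nekovář 2019 Thm. 0.3 (for `3 ∤ ∏c`)} — Poitou–Tate's reciprocity sum and Tate's local Euler–Poincaré characteristic are TREE
  theorems (`poitouTate_sum_localTatePairing_eq_zero_holds`, `GaloisImage.EP.localEulerPoincareCharacteristic_adicCompletion`), read inside.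
* §4 (appended) the (α)-RESIDUAL: `cornerAtThreeTwistLower_of_stepL_of_twistWitness_of_consumed` — with (U) cut to the consumer shape (U′) (plan g38's
  STAGED RULING 40 (α) text) the crux STILL outputs `CornerAtThreeTwistLower` (the rank-`0` lower bound at EVERY odd Heegner twin) through (L) ∀ frames;
  the remaining excess is the ∀-over-frames of (L).
* §3 `cornerAtThree_of_cornerAtThreeW` — class level, route decls BY NAME: `Theses.ClassRecordThree.CornerAtThreeW → Theses.ClassRecordThree.CornerAtThree`;
  `cornerAtThreeW_iff_cornerAtThree` — the EQUIVALENCE (backward by mult-p3's p556532 + Hoffstein–Luo).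

References: [JetchevSkinnerWan2017] §7.4.1 (eq:gz for K′), §7.4.2 (eq:shaupper), pp. 29–31; [GrossZagier1986] V §2; [MatarNekovar2019] Thm. 0.3;
[Miller2011LMS] Def. 1.1; [HoffsteinLuo1997] §1; [Mazur1978] Cor. 4.1; tree: `X11b/BDPRouteShaAn.lean` (multr1-p2), `…CornerTwinHalves` (mult-p3),
`X11b/Three/CornerResidual.lean` (x11b3), `X1/RankZeroPartner.lean`. presearch: n∕a (a statement about the tree's own typed cruxes).
-/

set_option autoImplicit false
set_option linter.dupNamespace false

noncomputable section

open scoped Classical NumberField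

open WeierstrassCurve NumberField IsDedekindDomain Literature.NumberTheory.EllipticCurves
  Literature.NumberTheory.EllipticCurves.ModularForms
  Literature.NumberTheory.EllipticCurves.Rank1Residual
  Literature.NumberTheory.EllipticCurves.Rank1Residual.Typed
  Literature.NumberTheory.QuadraticFields.Quadratic
  Literature.NumberTheory.GaloisCohomology Literature.NumberTheory.GaloisRepresentations
  Summit.BirchSwinnertonDyer.Rank1Residual
  Summit.BirchSwinnertonDyer.Rank1Residual.X11b
  Summit.BirchSwinnertonDyer.Rank1Residual.X11b.Three
  Summit.BirchSwinnertonDyer.BirchSwinnertonDyer.Theorems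
  Summit.BirchSwinnertonDyer.BirchSwinnertonDyer.Theorems.CornerTwinHalves

namespace Summit.BirchSwinnertonDyer.BirchSwinnertonDyer.Theorems.CornerStrength

/-! ### §1 Datum level: the twin's exact `3`-part from the two index inequalities and `BSD(E,3)` -/

/-- **Datum level.** Data: a corner-type pair (`r_an = 1`, `3` odd), an odd Heegner datum `(N, K, Dt, H, ι, P)` with `3 ∤ c(Dt)`, `3 ∤ #𝓞_K^×`,
`L(E^{(d_K)},1) ≠ 0`, and a globally minimal model `Wd = Cd • E^{(d_K)}` with `ord₃ u(Cd) = 0`, `ord₃ ∏c(Wd) = ord₃ ∏c(E)`. Granted the LOWER index inequality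
`2v(I) ≤ v(Ш_K) + 2v(∏c)` (STEP L's output, `hLow`) and the UPPER one `v(Ш_K) + 2v(∏c) ≤ 2v(I)` (Kolyvagin's sharp shape, `hUp`) at the datum — both asked only
for `P` of infinite order and `Ш(E/K)` finite — and `BSD(E,3)` in Miller's currency (`Typed.MissingPPartAt W 3`: `v(#Ш_an) = v(#Ш)`), the twist's rank-`0` print
shape `PPartRankZero Wd 3` (`v(L(Wd,1)/Ω) = v(Ш_d) + v(∏c_d) − 2v(t_d)`) follows: `L(Wd,1)/Ω(Wd) = q_d ∈ ℚ` by modular symbols (`hpar`,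
`X1.RankZeroPartner.exists_rat_entireLFunction_one_div_realPeriodRat`), multr1-p2's identity `v(q) + v(q_d) + v(∏c) + 2v(t_d) = 2v(I)` with `v(Ш_K) = v(Ш_W) + v(Ш_d)`
(`X11b.exists_shaAn_padicVal_eq_of_heegner`), uniqueness of the rational `#Ш_an`, and `omega`. PUBLISHED binders `hGZ`, `hKo`, `hGZK`, `hmod`, `hpar`.
CONDITIONAL; nothing booked. [cite: JetchevSkinnerWan2017, §7.4.1 (eq:gz for K′), pp. 29–30] [cite: Miller2011LMS, §1 and Def. 1.1] -/
theorem pPartRankZero_twist_of_indexBounds_of_missingPPartAt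
    (W : WeierstrassCurve ℚ) [W.IsElliptic] [W.IsGloballyMinimal]
    (N : ℕ) [NeZero N] (K : Type) [Field K] [NumberField K]
    (Dt : ModularParametrizationData W N) (H : HeegnerDatum N (NumberField.discr K)) (ι : K →+* ℂ)
    (P : (W.baseChange K).toAffine.Point)
    (hGZ : gross_zagier N W K) (hKo : kolyvagin N W K)
    (hGZK : rank_eq_analyticRank_of_analyticRank_le_one) (hmod : hasEntireLFunction_rat)
    (hpar : nonempty_modularParametrizationData)
    (hK : IsImaginaryQuadratic K) (hHN : SatisfiesHeegnerHypothesis N K)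
    (hP : WeierstrassCurve.Affine.Point.map ι.toRatAlgHom P = heegnerPointComplex Dt H)
    (hc : ¬ (3 : ℤ) ∣ Dt.c) (hμ : ¬ 3 ∣ Units.torsionOrder K) (hr : W.analyticRank = 1)
    (hLt : (W.quadraticTwist (NumberField.discr K : ℚ)).entireLFunction 1 ≠ 0)
    (Wd : WeierstrassCurve ℚ) [Wd.IsElliptic] [Wd.IsGloballyMinimal] (Cd : VariableChange ℚ)
    (hWd : Cd • W.quadraticTwist (NumberField.discr K : ℚ) = Wd) (hu : padicValRat 3 (Cd.u : ℚ) = 0)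
    (htam : padicValNat 3 Wd.tamagawaProduct = padicValNat 3 W.tamagawaProduct)
    (hPP : Typed.MissingPPartAt W 3)
    (hLow : ¬ IsOfFinAddOrder P →
      2 * padicValNat 3 (AddSubgroup.zmultiples P).index ≤
        padicValNat 3 (W.baseChange K).shaOrder + 2 * padicValNat 3 W.tamagawaProduct)
    (hUp : Finite (W.baseChange K).sha → ¬ IsOfFinAddOrder P →
      padicValNat 3 (W.baseChange K).shaOrder + 2 * padicValNat 3 W.tamagawaProduct ≤
        2 * padicValNat 3 (AddSubgroup.zmultiples P).index) :
    PPartRankZero Wd 3 := by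
  haveI : Fact (Nat.Prime 3) := ⟨Nat.prime_three⟩
  -- `L(Wd,1)/Ω(Wd)` is rational (modular symbols)
  obtain ⟨qd, hqd⟩ := X1.RankZeroPartner.exists_rat_entireLFunction_one_div_realPeriodRat hpar Wd
  -- the exact Gross–Zagier bookkeeping identity at the datum
  obtain ⟨-, hfinK, hsha, q, hq, hval⟩ := exists_shaAn_padicVal_eq_of_heegner W 3 N K Dt H ι P
    hGZ hKo hGZK hmod hK hHN hP (by decide) hc hμ hr hLt Wd Cd hWd hu qd hqd
  -- the Heegner point has infinite order (`L'(E,1) ≠ 0`, `L(E^D,1) ≠ 0`, Gross–Zagier)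
  have hPinf : ¬ IsOfFinAddOrder P :=
    not_isOfFinAddOrder_of_heegner_of_analyticRank_eq_one W N K Dt H ι P hGZ hmod hr hK hHN hLt hP
  -- `BSD(E,3)`: `v(#Ш_an) = v(#Ш(E))`, the rational `#Ш_an` being unique
  obtain ⟨q', hq', hvq'⟩ := hPP
  have hqq : q' = q := by exact_mod_cast hq'.symm.trans hq
  subst hqq
  refine ⟨qd, hqd, ?_⟩
  have e1 : (2 * padicValNat 3 (AddSubgroup.zmultiples P).index : ℤ) =
      padicValNat 3 (W.baseChange K).shaOrder + 2 * padicValNat 3 W.tamagawaProduct := by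
    have h1 := hLow hPinf
    have h2 := hUp hfinK hPinf
    omega
  have e2 : (padicValNat 3 (W.baseChange K).shaOrder : ℤ) =
      padicValNat 3 W.shaOrder + padicValNat 3 Wd.shaOrder := by exact_mod_cast hsha
  have e3 : (padicValNat 3 Wd.tamagawaProduct : ℤ) = padicValNat 3 W.tamagawaProduct := by
    exact_mod_cast htam
  omega

/-! ### §2 Curve level: (L) ∧ (W) ∧ (U) ⟹ (Tw) at EVERY odd Heegner twin -/

/-- **(L) ∧ (W) ∧ (U) ⟹ `Three.CornerTwistAt W` (`BSD(E^{(d_K)},3)` at EVERY odd Heegner twin), modulo print.** For a corner curve (`(E,3) ∈` X11b,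
`ρ̄_{E,3}` not onto) carrying `CornerStepLAt W` (L), `CornerTwistWitness.CornerTwistWitnessAt W` (W) and `CornerUpperAt W` (U): (1) `BSD(E,3)` in Miller's
currency by the route's own squeeze `CornerTwinHalves.missingPPartAt_of_corner_of_twoTwins` with F1′ = F2′ = the witness (`cornerTwin{Lower,Upper}At_of_cornerTwistWitnessAt`)
and the (U)-replay `missingUpperBoundAt_of_dvd_of_cornerUpperAt_of_twinLower`; (2) at an ARBITRARY odd Heegner frame `K` (Heegner for `N(E)`, `L(E^{(d_K)},1) ≠ 0`,
`Wd = Cd • E^{(d_K)}` globally minimal): a Manin-good datum exists THERE (`exists_maninDatum_of_odd`: newforms, Mazur 1978 Cor. 4.1, Néron scaling — a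
tree theorem), `3 ∤ d_K`, `3 ∤ #𝓞_K^×` since `3 ∣ N` splits; the LOWER index inequality is (L) through x11b3's image-free bridge
`indexLowerBoundAt_of_cornerStepLAt` (Poitou–Tate sum and local Euler–Poincaré = tree theorems); the UPPER one is (U) itself on `3 ∣ ∏c` and Matar–Nekovář 2019
Thm. 0.3 (`hMN`, `d_K ∉ {−3, −4}`) on `3 ∤ ∏c`; §1 gives `PPartRankZero Wd 3`, whence `BSDp Wd 3` (`bsdp_of_pPartRankZero`, `r_an(Wd) = 0`). So the ∃-recut (W)
of RULING 33 does NOT weaken the crux: with (L) and (U) typed at every frame, one twin pins them all. CONDITIONAL on the three conjuncts and the eight print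
binders; nothing booked. [cite: JetchevSkinnerWan2017, §7.4.1–§7.4.2, pp. 29–31] [cite: MatarNekovar2019, Thm. 0.3 (p. 456)] [cite: Mazur1978, Cor. 4.1]
[cite: MilneADT2006, Ch. I, Thm. 4.10(b) and Thm. 2.8] [cite: Miller2011LMS, Def. 1.1] -/
theorem cornerTwistAt_of_stepL_of_twistWitness_of_upper [Fact (Nat.Prime 3)]
    (hGZ : ∀ (N : ℕ) [NeZero N] (W : WeierstrassCurve ℚ) (K : Type) [Field K] [NumberField K],
      gross_zagier N W K)
    (hKo : ∀ (N : ℕ) [NeZero N] (W : WeierstrassCurve ℚ) (K : Type) [Field K] [NumberField K],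
      kolyvagin N W K)
    (hGZK : rank_eq_analyticRank_of_analyticRank_le_one) (hmod : hasEntireLFunction_rat)
    (hnf : exists_isNewformOf) (hMaz : mazur_not_dvd_maninConstant_of_odd)
    (hpar : nonempty_modularParametrizationData)
    (hMN : ∀ (N : ℕ) [NeZero N] (W : WeierstrassCurve ℚ) (K : Type) [Field K] [NumberField K],
      MatarNekovar2019.thm03_padicValNat_card_sha_le_of_irreducible N W K)
    (W : WeierstrassCurve ℚ) [W.IsElliptic] [W.IsGloballyMinimal] (hX : ClassX11b W 3) (hns : ¬ Surj W 3)
    (hSL : CornerStepLAt W) (hTW : CornerTwistWitness.CornerTwistWitnessAt W) (hUp : CornerUpperAt W) :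
    CornerTwistAt W := by
  intro K _ _ Wd _ _ Cd _ _ hK hodd hHN hLt hWd
  have hNS : integral_neronScaling_of_isGloballyMinimal :=
    integral_neronScaling_of_isGloballyMinimal_holds
  obtain ⟨hr, hp2, hmult, hirr⟩ := id hX
  haveI : NeZero (W.conductorNorm ℤ) := ⟨(W.conductorNorm_pos_holds).ne'⟩
  -- (1) `BSD(E,3)` from (L), (U) and the witness (the route's own squeeze, F1′ = F2′ = the witness)
  have hF1 : CornerTwinLowerAt W := cornerTwinLowerAt_of_cornerTwistWitnessAt hGZK hmod W hTW
  have hF2 : CornerTwinUpperAt W := cornerTwinUpperAt_of_cornerTwistWitnessAt hGZK hmod W hTW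
  have hPP : Typed.MissingPPartAt W 3 :=
    missingPPartAt_of_corner_of_twoTwins hGZ hKo hGZK hmod hnf hMaz poitouTate_sum_localTatePairing_eq_zero_holds
      GaloisImage.EP.localEulerPoincareCharacteristic_adicCompletion hMN W hX hns hSL hF1 hF2
      (missingUpperBoundAt_of_dvd_of_cornerUpperAt_of_twinLower hGZ hKo hGZK hmod hnf hMaz W hX hns hUp hF1)
  -- (2) a Manin-good Heegner datum AT the given frame, and the side conditions from `3 ∣ N` split
  obtain ⟨Dt, H, ι, P, hP, hc⟩ :=
    exists_maninDatum_of_odd hnf hMaz hNS W 3 (W.conductorNorm ℤ) K rfl hp2 hmult hirr hK hHN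
  have hpN : 3 ∣ W.conductorNorm ℤ :=
    (W.dvd_conductorNorm_iff_not_hasGoodReductionAtPrime 3).mpr
      (WeierstrassCurve.HasMultiplicativeReduction.not_hasGoodReduction (R := ℤ_[3]) hmult)
  obtain ⟨hpd, hμ⟩ := Three.not_dvd_discr_and_not_dvd_torsionOrder_of_heegner (p := 3) hK hHN hp2 hpN
  have hD0 : (NumberField.discr K : ℚ) ≠ 0 := by exact_mod_cast NumberField.discr_ne_zero K
  haveI hEt : (W.quadraticTwist (NumberField.discr K : ℚ)).IsElliptic := W.isElliptic_quadraticTwist hD0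
  have hu : padicValRat 3 (Cd.u : ℚ) = 0 := padicValRat_u_eq_zero_of_twist_minimal W 3 K hK hHN hmult Cd hWd
  have htam : padicValNat 3 Wd.tamagawaProduct = padicValNat 3 W.tamagawaProduct :=
    X2.padicValNat_tamagawaProduct_twist_of_heegner_of_odd W 3 hp2 K hK hodd hpd hHN Cd hWd
  have hLt' : (W.quadraticTwist (NumberField.discr K : ℚ)).entireLFunction = Wd.entireLFunction := by
    rw [← hWd, entireLFunction_smul]
  have hLd1 : Wd.entireLFunction 1 ≠ 0 := by rw [← hLt']; exact hLt
  have hrd : Wd.analyticRank = 0 := (Wd.analyticRank_eq_zero_iff_holds (hmod Wd)).2 hLd1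
  -- (3) the twin's exact `3`-part from the two index inequalities at the datum
  have hPR : PPartRankZero Wd 3 := by
    refine pPartRankZero_twist_of_indexBounds_of_missingPPartAt W (W.conductorNorm ℤ) K Dt H ι P (hGZ _ W K)
      (hKo _ W K) hGZK hmod hpar hK hHN hP hc hμ hr hLt Wd Cd hWd hu htam hPP ?_ ?_
    · -- LOWER: STEP L at the datum through the image-free bridge
      intro _
      exact indexLowerBoundAt_of_cornerStepLAt hGZ hKo hmod poitouTate_sum_localTatePairing_eq_zero_holds
        GaloisImage.EP.localEulerPoincareCharacteristic_adicCompletion W hX hns hSL (W.conductorNorm ℤ) K Dt H ι P rfl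
        hK hodd hHN hLt hP hc
    · -- UPPER: (U) on `3 ∣ ∏c`; Matar–Nekovář on `3 ∤ ∏c`
      intro hfin hPinf
      by_cases ht : 3 ∣ W.tamagawaProduct
      · exact hUp (W.conductorNorm ℤ) K Dt H ι P hX hns ht rfl hK hodd hHN hLt hP hc hPinf hfin
      · have h0 : padicValNat 3 W.tamagawaProduct = 0 := padicValNat.eq_zero_of_not_dvd ht
        have hD3 : NumberField.discr K ≠ -3 := fun h ↦ hpd ⟨-1, by rw [h]; norm_num⟩
        have hD4 : NumberField.discr K ≠ -4 := fun h ↦ by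
          rw [h] at hodd; exact absurd hodd (by decide)
        have hMNK : padicValNat 3 (W.baseChange K).shaOrder ≤ 2 * padicValNat 3 (AddSubgroup.zmultiples P).index :=
          hMN _ W K hK hHN hD3 hD4 ⟨Dt, H, ι, hP⟩ hPinf Nat.prime_three (by decide) hirr
        omega
  exact bsdp_of_pPartRankZero Wd 3 hmod hGZK hrd hPR

/-! ### §3 Class level, route decls BY NAME: `CornerAtThreeW` (21420) ⟹ `CornerAtThree` (19111) -/

/-- **STRENGTH CERTIFICATE: `Theses.ClassRecordThree.CornerAtThreeW → Theses.ClassRecordThree.CornerAtThree`, modulo named print.** The twist-witness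
crux of item 21420 implies the ∀-(Tw) crux of item 19111 (aside since plan g37 RULING 33); the converse is mult-p3's `cornerTwistWitnessAt_of_cornerTwistAt`
+ Hoffstein–Luo (p556532). So the two corner cruxes are EQUIVALENT modulo {Gross–Zagier, Kolyvagin, GZK, modularity, newforms, Mazur's Manin constant,
the parametrisation supply, Matar–Nekovář 2019 Thm. 0.3} (Poitou–Tate's reciprocity sum and Tate's local Euler–Poincaré characteristic are tree theorems). CONDITIONAL; closes nothing;
EVIDENCE for the planner (RULING 33 ∕ RULING 40 (α)): the honest weakening of the corner crux is in the ∀-over-frames of (L) and (U), not in (Tw) ↦ (W).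
[cite: JetchevSkinnerWan2017, §7.4.1–§7.4.2] [cite: MatarNekovar2019, Thm. 0.3] [cite: HoffsteinLuo1997, Theorem (§1)] [cite: Miller2011LMS, Def. 1.1] -/
theorem cornerAtThree_of_cornerAtThreeW
    (hGZ : ∀ (N : ℕ) [NeZero N] (W : WeierstrassCurve ℚ) (K : Type) [Field K] [NumberField K],
      gross_zagier N W K)
    (hKo : ∀ (N : ℕ) [NeZero N] (W : WeierstrassCurve ℚ) (K : Type) [Field K] [NumberField K],
      kolyvagin N W K)
    (hGZK : rank_eq_analyticRank_of_analyticRank_le_one) (hmod : hasEntireLFunction_rat)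
    (hnf : exists_isNewformOf) (hMaz : mazur_not_dvd_maninConstant_of_odd)
    (hpar : nonempty_modularParametrizationData)
    (hMN : ∀ (N : ℕ) [NeZero N] (W : WeierstrassCurve ℚ) (K : Type) [Field K] [NumberField K],
      MatarNekovar2019.thm03_padicValNat_card_sha_le_of_irreducible N W K)
    (h : Summit.BirchSwinnertonDyer.BirchSwinnertonDyer.Theses.ClassRecordThree.CornerAtThreeW) :
    Summit.BirchSwinnertonDyer.BirchSwinnertonDyer.Theses.ClassRecordThree.CornerAtThree := by
  haveI : Fact (Nat.Prime 3) := ⟨Nat.prime_three⟩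
  intro W _ _
  obtain ⟨hSL, hTW, hUp⟩ := h W
  refine ⟨hSL, ?_, hUp⟩
  by_cases hX : ClassX11b W 3
  · by_cases hns : ¬ Surj W 3
    · exact cornerTwistAt_of_stepL_of_twistWitness_of_upper hGZ hKo hGZK hmod hnf hMaz hpar hMN W hX hns hSL hTW hUp
    · intro K _ _ Wd _ _ Cd _ hns' _ _ _ _ _
      exact absurd hns' hns
  · intro K _ _ Wd _ _ Cd hX' _ _ _ _ _ _
    exact absurd hX' hX

/-- **The two corner cruxes are EQUIVALENT modulo named print**: `Theses.ClassRecordThree.CornerAtThreeW ↔ Theses.ClassRecordThree.CornerAtThree`.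
Forward = `cornerAtThree_of_cornerAtThreeW`; backward = mult-p3's `CornerTwistWitness.cornerTwistWitnessAt_of_cornerTwistAt` (Hoffstein–Luo `hHL` + newforms
supply ONE admissible odd Heegner twin; p556532) on conjunct 2, conjuncts 1 and 3 verbatim. CONDITIONAL on the nine print binders; closes nothing; EVIDENCE only.
[cite: HoffsteinLuo1997, Theorem (§1)] [cite: JetchevSkinnerWan2017, §7.4.1–§7.4.2] [cite: MatarNekovar2019, Thm. 0.3] -/
theorem cornerAtThreeW_iff_cornerAtThree
    (hGZ : ∀ (N : ℕ) [NeZero N] (W : WeierstrassCurve ℚ) (K : Type) [Field K] [NumberField K],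
      gross_zagier N W K)
    (hKo : ∀ (N : ℕ) [NeZero N] (W : WeierstrassCurve ℚ) (K : Type) [Field K] [NumberField K],
      kolyvagin N W K)
    (hGZK : rank_eq_analyticRank_of_analyticRank_le_one) (hmod : hasEntireLFunction_rat)
    (hnf : exists_isNewformOf) (hMaz : mazur_not_dvd_maninConstant_of_odd)
    (hpar : nonempty_modularParametrizationData) (hHL : HoffsteinLuo1997_exists_twist_L_one_ne_zero)
    (hMN : ∀ (N : ℕ) [NeZero N] (W : WeierstrassCurve ℚ) (K : Type) [Field K] [NumberField K],
      MatarNekovar2019.thm03_padicValNat_card_sha_le_of_irreducible N W K) :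
    Summit.BirchSwinnertonDyer.BirchSwinnertonDyer.Theses.ClassRecordThree.CornerAtThreeW ↔
      Summit.BirchSwinnertonDyer.BirchSwinnertonDyer.Theses.ClassRecordThree.CornerAtThree :=
  ⟨cornerAtThree_of_cornerAtThreeW hGZ hKo hGZK hmod hnf hMaz hpar hMN,
    fun h W _ _ ↦ ⟨(h W).1, CornerTwistWitness.cornerTwistWitnessAt_of_cornerTwistAt hnf hHL W (h W).2.1, (h W).2.2⟩⟩

/-! ### §4 (appended, lane B g16) The (α)-RESIDUAL: with (U) cut to the consumer shape (U′), the crux STILL outputs the rank-0 lower bound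
at EVERY odd Heegner twin — the remaining excess is the ∀-over-frames of (L) -/

/-- **Datum level, LOWER half only.** As `pPartRankZero_twist_of_indexBounds_of_missingPPartAt` WITHOUT the upper index inequality: from the LOWER one
(`2v(I) ≤ v(Ш_K) + 2v(∏c)`, STEP L's output) and `BSD(E,3)` in Miller's currency, the twin's `≥`-half in print shape
`∃ q_d = L(Wd,1)/Ω(Wd) ∈ ℚ, v(q_d) ≤ v(Ш_d) + v(∏c_d) − 2v(t_d)`. Same identity, `omega` with one inequality. PUBLISHED binders `hGZ`, `hKo`, `hGZK`, `hmod`,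
`hpar`. CONDITIONAL; nothing booked. [cite: JetchevSkinnerWan2017, §7.4.1 (eq:gz for K′, eq:shalowerK-1), pp. 29–30] [cite: Miller2011LMS, Def. 1.1] -/
theorem printShapeLower_twist_of_indexLower_of_missingPPartAt
    (W : WeierstrassCurve ℚ) [W.IsElliptic] [W.IsGloballyMinimal]
    (N : ℕ) [NeZero N] (K : Type) [Field K] [NumberField K]
    (Dt : ModularParametrizationData W N) (H : HeegnerDatum N (NumberField.discr K)) (ι : K →+* ℂ)
    (P : (W.baseChange K).toAffine.Point)
    (hGZ : gross_zagier N W K) (hKo : kolyvagin N W K)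
    (hGZK : rank_eq_analyticRank_of_analyticRank_le_one) (hmod : hasEntireLFunction_rat)
    (hpar : nonempty_modularParametrizationData)
    (hK : IsImaginaryQuadratic K) (hHN : SatisfiesHeegnerHypothesis N K)
    (hP : WeierstrassCurve.Affine.Point.map ι.toRatAlgHom P = heegnerPointComplex Dt H)
    (hc : ¬ (3 : ℤ) ∣ Dt.c) (hμ : ¬ 3 ∣ Units.torsionOrder K) (hr : W.analyticRank = 1)
    (hLt : (W.quadraticTwist (NumberField.discr K : ℚ)).entireLFunction 1 ≠ 0)
    (Wd : WeierstrassCurve ℚ) [Wd.IsElliptic] [Wd.IsGloballyMinimal] (Cd : VariableChange ℚ)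
    (hWd : Cd • W.quadraticTwist (NumberField.discr K : ℚ) = Wd) (hu : padicValRat 3 (Cd.u : ℚ) = 0)
    (htam : padicValNat 3 Wd.tamagawaProduct = padicValNat 3 W.tamagawaProduct)
    (hPP : Typed.MissingPPartAt W 3)
    (hLow : ¬ IsOfFinAddOrder P →
      2 * padicValNat 3 (AddSubgroup.zmultiples P).index ≤
        padicValNat 3 (W.baseChange K).shaOrder + 2 * padicValNat 3 W.tamagawaProduct) :
    ∃ q : ℚ, Wd.entireLFunction 1 / (Wd.realPeriodRat : ℂ) = (q : ℂ) ∧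
      padicValRat 3 q ≤ (padicValNat 3 Wd.shaOrder : ℤ) + padicValNat 3 Wd.tamagawaProduct -
        2 * padicValNat 3 Wd.torsionOrder := by
  haveI : Fact (Nat.Prime 3) := ⟨Nat.prime_three⟩
  obtain ⟨qd, hqd⟩ := X1.RankZeroPartner.exists_rat_entireLFunction_one_div_realPeriodRat hpar Wd
  obtain ⟨-, -, hsha, q, hq, hval⟩ := exists_shaAn_padicVal_eq_of_heegner W 3 N K Dt H ι P
    hGZ hKo hGZK hmod hK hHN hP (by decide) hc hμ hr hLt Wd Cd hWd hu qd hqd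
  have hPinf : ¬ IsOfFinAddOrder P :=
    not_isOfFinAddOrder_of_heegner_of_analyticRank_eq_one W N K Dt H ι P hGZ hmod hr hK hHN hLt hP
  obtain ⟨q', hq', hvq'⟩ := hPP
  have hqq : q' = q := by exact_mod_cast hq'.symm.trans hq
  subst hqq
  refine ⟨qd, hqd, ?_⟩
  have h1 := hLow hPinf
  have e2 : (padicValNat 3 (W.baseChange K).shaOrder : ℤ) =
      padicValNat 3 W.shaOrder + padicValNat 3 Wd.shaOrder := by exact_mod_cast hsha
  have e3 : (padicValNat 3 Wd.tamagawaProduct : ℤ) = padicValNat 3 W.tamagawaProduct := by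
    exact_mod_cast htam
  omega

/-- **The (α)-RESIDUAL, curve level: (L) ∧ (W) ∧ (U′) ⟹ the rank-`0` main-conjecture LOWER bound `Typed.MissingLowerBoundAt Wd 3` at EVERY odd
Heegner twin.** Here (U′) is the CONSUMER shape `3 ∣ ∏c → Typed.MissingUpperBoundAt W 3` — the third conjunct of plan g38's STAGED (director-gated,
ON HOLD) RULING 40 (α) text `CornerConsumedAtThree`. So even after (α) the corner crux would still OUTPUT `CornerAtThreeTwistLower` (Skinner–Urban grade,
VOID in print) at every twin: (1) `BSD(E,3)` from (L), (U′) and the witness (mult-p3's squeeze); (2) at an arbitrary odd Heegner frame, a Manin-good datum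
(`exists_maninDatum_of_odd`), STEP L there through x11b3's image-free bridge (Poitou–Tate sum and local Euler–Poincaré = tree theorems), and
`printShapeLower_twist_of_indexLower_of_missingPPartAt`; (3) the print shape is `Typed.MissingLowerBoundAt Wd 3` by lane B g16's
`TwistKatoHalf.missingLowerBoundAt_of_printShape_lower_rankZero`. The remaining excess of the crux over what `closes` consumes is therefore the
∀-over-frames of (L). CONDITIONAL on the three inputs and eight print binders; nothing booked; EVIDENCE only.
[cite: JetchevSkinnerWan2017, §7.4.1, pp. 29–30] [cite: MatarNekovar2019, Thm. 0.3] [cite: Mazur1978, Cor. 4.1] [cite: Miller2011LMS, Def. 1.1] -/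
theorem twistLower_of_stepL_of_twistWitness_of_consumed [Fact (Nat.Prime 3)]
    (hGZ : ∀ (N : ℕ) [NeZero N] (W : WeierstrassCurve ℚ) (K : Type) [Field K] [NumberField K],
      gross_zagier N W K)
    (hKo : ∀ (N : ℕ) [NeZero N] (W : WeierstrassCurve ℚ) (K : Type) [Field K] [NumberField K],
      kolyvagin N W K)
    (hGZK : rank_eq_analyticRank_of_analyticRank_le_one) (hmod : hasEntireLFunction_rat)
    (hnf : exists_isNewformOf) (hMaz : mazur_not_dvd_maninConstant_of_odd)
    (hpar : nonempty_modularParametrizationData)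
    (hMN : ∀ (N : ℕ) [NeZero N] (W : WeierstrassCurve ℚ) (K : Type) [Field K] [NumberField K],
      MatarNekovar2019.thm03_padicValNat_card_sha_le_of_irreducible N W K)
    (W : WeierstrassCurve ℚ) [W.IsElliptic] [W.IsGloballyMinimal] (hX : ClassX11b W 3) (hns : ¬ Surj W 3)
    (hSL : CornerStepLAt W) (hTW : CornerTwistWitness.CornerTwistWitnessAt W)
    (hU' : 3 ∣ W.tamagawaProduct → Typed.MissingUpperBoundAt W 3)
    (K : Type) [Field K] [NumberField K]
    (Wd : WeierstrassCurve ℚ) [Wd.IsElliptic] [Wd.IsGloballyMinimal] (Cd : VariableChange ℚ)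
    (hK : IsImaginaryQuadratic K) (hodd : Odd (NumberField.discr K))
    (hHN : SatisfiesHeegnerHypothesis (W.conductorNorm ℤ) K)
    (hLt : (W.quadraticTwist (NumberField.discr K : ℚ)).entireLFunction 1 ≠ 0)
    (hWd : Cd • W.quadraticTwist (NumberField.discr K : ℚ) = Wd) :
    Typed.MissingLowerBoundAt Wd 3 := by
  have hNS : integral_neronScaling_of_isGloballyMinimal :=
    integral_neronScaling_of_isGloballyMinimal_holds
  obtain ⟨hr, hp2, hmult, hirr⟩ := id hX
  haveI : NeZero (W.conductorNorm ℤ) := ⟨(W.conductorNorm_pos_holds).ne'⟩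
  -- (1) `BSD(E,3)` from (L), (U′) and the witness
  have hF1 : CornerTwinLowerAt W := cornerTwinLowerAt_of_cornerTwistWitnessAt hGZK hmod W hTW
  have hF2 : CornerTwinUpperAt W := cornerTwinUpperAt_of_cornerTwistWitnessAt hGZK hmod W hTW
  have hPP : Typed.MissingPPartAt W 3 :=
    missingPPartAt_of_corner_of_twoTwins hGZ hKo hGZK hmod hnf hMaz poitouTate_sum_localTatePairing_eq_zero_holds
      GaloisImage.EP.localEulerPoincareCharacteristic_adicCompletion hMN W hX hns hSL hF1 hF2 hU'
  -- (2) a Manin-good datum at the frame; STEP L there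
  obtain ⟨Dt, H, ι, P, hP, hc⟩ :=
    exists_maninDatum_of_odd hnf hMaz hNS W 3 (W.conductorNorm ℤ) K rfl hp2 hmult hirr hK hHN
  have hpN : 3 ∣ W.conductorNorm ℤ :=
    (W.dvd_conductorNorm_iff_not_hasGoodReductionAtPrime 3).mpr
      (WeierstrassCurve.HasMultiplicativeReduction.not_hasGoodReduction (R := ℤ_[3]) hmult)
  obtain ⟨hpd, hμ⟩ := Three.not_dvd_discr_and_not_dvd_torsionOrder_of_heegner (p := 3) hK hHN hp2 hpN
  have hD0 : (NumberField.discr K : ℚ) ≠ 0 := by exact_mod_cast NumberField.discr_ne_zero K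
  haveI hEt : (W.quadraticTwist (NumberField.discr K : ℚ)).IsElliptic := W.isElliptic_quadraticTwist hD0
  have hu : padicValRat 3 (Cd.u : ℚ) = 0 := padicValRat_u_eq_zero_of_twist_minimal W 3 K hK hHN hmult Cd hWd
  have htam : padicValNat 3 Wd.tamagawaProduct = padicValNat 3 W.tamagawaProduct :=
    X2.padicValNat_tamagawaProduct_twist_of_heegner_of_odd W 3 hp2 K hK hodd hpd hHN Cd hWd
  have hLt' : (W.quadraticTwist (NumberField.discr K : ℚ)).entireLFunction = Wd.entireLFunction := by
    rw [← hWd, entireLFunction_smul]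
  have hLd1 : Wd.entireLFunction 1 ≠ 0 := by rw [← hLt']; exact hLt
  have hrd : Wd.analyticRank = 0 := (Wd.analyticRank_eq_zero_iff_holds (hmod Wd)).2 hLd1
  obtain ⟨qd, hqd, hvle⟩ := printShapeLower_twist_of_indexLower_of_missingPPartAt W (W.conductorNorm ℤ) K Dt H ι P
    (hGZ _ W K) (hKo _ W K) hGZK hmod hpar hK hHN hP hc hμ hr hLt Wd Cd hWd hu htam hPP
    (fun _ ↦ indexLowerBoundAt_of_cornerStepLAt hGZ hKo hmod poitouTate_sum_localTatePairing_eq_zero_holds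
      GaloisImage.EP.localEulerPoincareCharacteristic_adicCompletion W hX hns hSL (W.conductorNorm ℤ) K Dt H ι P rfl
      hK hodd hHN hLt hP hc)
  -- (3) the print shape is the cell's `MissingLowerBoundAt`
  exact TwistKatoHalf.missingLowerBoundAt_of_printShape_lower_rankZero Wd 3 hGZK hrd hLd1 hqd hvle

/-- **The (α)-RESIDUAL, class level: `Theorems.CornerAtThreeStepL → (∀ W, CornerTwistWitnessAt W) → Theorems.CornerAtThreeUpperConsumed →
Theorems.CornerAtThreeTwistLower`, modulo eight named print facts.** The three hypotheses are (conjunct-wise) plan g38's STAGED RULING 40 (α) text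
`CornerConsumedAtThree`; the conclusion is the registered r1–r21 stub `stub_cornerTwistLower3`'s type — the rank-`0` main-conjecture lower bound at EVERY
odd Heegner twin of every corner curve. So (α) alone leaves a ∀-over-twins Skinner–Urban-grade OUTPUT in the crux; cutting (L) to the witness frame as
well is what aligns the crux with what `closes` consumes. CONDITIONAL; closes nothing; EVIDENCE only (nothing applied, no restate proposed here).
[cite: JetchevSkinnerWan2017, §7.4.1, pp. 29–30] [cite: Skinner2016PacificMC, Thm. C (shape only)] [cite: Miller2011LMS, Def. 1.1] -/
theorem cornerAtThreeTwistLower_of_stepL_of_twistWitness_of_consumed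
    (hGZ : ∀ (N : ℕ) [NeZero N] (W : WeierstrassCurve ℚ) (K : Type) [Field K] [NumberField K],
      gross_zagier N W K)
    (hKo : ∀ (N : ℕ) [NeZero N] (W : WeierstrassCurve ℚ) (K : Type) [Field K] [NumberField K],
      kolyvagin N W K)
    (hGZK : rank_eq_analyticRank_of_analyticRank_le_one) (hmod : hasEntireLFunction_rat)
    (hnf : exists_isNewformOf) (hMaz : mazur_not_dvd_maninConstant_of_odd)
    (hpar : nonempty_modularParametrizationData)
    (hMN : ∀ (N : ℕ) [NeZero N] (W : WeierstrassCurve ℚ) (K : Type) [Field K] [NumberField K],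
      MatarNekovar2019.thm03_padicValNat_card_sha_le_of_irreducible N W K)
    (hS : CornerAtThreeStepL)
    (hTW : ∀ (W : WeierstrassCurve ℚ) [W.IsElliptic] [W.IsGloballyMinimal], CornerTwistWitness.CornerTwistWitnessAt W)
    (hU' : CornerAtThreeUpperConsumed) :
    CornerAtThreeTwistLower := by
  haveI : Fact (Nat.Prime 3) := ⟨Nat.prime_three⟩
  intro W _ _ K _ _ Wd _ _ Cd hX hns hK hodd hHN hLt hWd
  exact twistLower_of_stepL_of_twistWitness_of_consumed hGZ hKo hGZK hmod hnf hMaz hpar hMN W hX hns (hS W) (hTW W)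
    (fun ht ↦ hU' W hX hns ht) K Wd Cd hK hodd hHN hLt hWd

end Summit.BirchSwinnertonDyer.BirchSwinnertonDyer.Theorems.CornerStrength

end
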